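import Mathlib

/-!
# Curves of hyperbolic (real-rooted) polynomials: Lemma 3.6, closedness, and the Multiplicity Lemma 3.7
# of Alekseevsky–Kriegl–Losik–Michor (1998), §3

Source: D. Alekseevsky, A. Kriegl, M. Losik, P. W. Michor, *Choosing roots of polynomials smoothly*, Israel J. Math.
105 (1998) 203–233 [AlekseevskyEtAl1998] (held text `paper:arxiv-math_9801026`; locators below are to its pages).
Conventions of the paper (§3.1, p.3): `P(x) = xⁿ − a₁xⁿ⁻¹ + a₂xⁿ⁻² − ⋯ + (−1)ⁿaₙ = ∏ (x − xᵢ)`, `aₖ = σₖ(x)`;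
«all roots real» = hyperbolic; for a curve `t ↦ P(t)` and a function `f`, `m(f)` = multiplicity (order of
flatness) of `t ↦ f(P(t))` at `t = 0` (§3.5).

What is here (all PROVED; Mathlib only; no definitions, no named facts):
* `eq_X_pow_of_coeff_eq_zero` — **Lemma 3.6** (p.4 L90–97): a real-rooted monic `P` of degree `n ≥ 2` with
  `a₁ = a₂ = 0` is `xⁿ` («`Σ xᵢ² = a₁² − 2a₂ = 0`»).
* `splits_of_tendsto` — the CLOSEDNESS of the set of real-rooted monic polynomials of fixed degree under
  coefficientwise limits (the consequence of Theorem 3.2 (Sylvester) used in the proof of 3.7, p.4 L150–152 «by theorem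
  3.2 the set of polynomials with all roots real is closed»), here in filter form and proved by the elementary estimate
  `|Im z|ⁿ ≤ |P(z)|` for real-rooted monic `P` (each factor `|z − xᵢ| ≥ |Im z|`) instead of Hermite–Sylvester.
* `multiplicity_lemma` — **Multiplicity Lemma 3.7, (3) ⇒ (1)** (p.4 L100 – p.5 L22): for a curve of monic
  real-rooted polynomials `P(t)(x) = xⁿ + Σ_{j<n} c_j(t) xʲ` with `c_{n−1} ≡ 0` («`a₁ = 0`») and, HERE, POLYNOMIAL
  coefficient functions `c_j ∈ ℝ[t]` (the paper: `C^∞` curves; the tree's consumer — the Valiant-summit line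
  `osculation_law`, `stub_peel` — has polynomial coefficients): if `m(a₂) ≥ 2r` then `m(aₖ) ≥ k r` for all `2 ≤ k ≤ n`,
  i.e. `t^{2r} ∣ c_{n−2} ⇒ t^{kr} ∣ c_{n−k}`.  Real-rootedness is only needed for `t > 0` near `0` (as in the printed
  proof: scaling `x = t^{p/q} u` for `t > 0`, closedness at `t → 0⁺`, Lemma 3.6).
  -- TODO(general form): `C^∞` / `Cⁿ` coefficient curves with `m(·)` the order of flatness of §3.5, and the full
  -- equivalence (1) ⇔ (2) ⇔ (3) with the `Δ̃ₖ` of §3.1.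

Honest framing: Literature layer (tools for the 18050 `stub_peel` general-`r` end-cost count, val-neg-1 memo
NOTE-neg1-18050-endcost-adversary.md); nothing here bears on `VP ≠ VNP`.
-/

noncomputable section

open Polynomial Finset Filter Topology

namespace Literature.Algebra.Polynomial

namespace AKLM

/-! ## Helpers on the fibre shape `xⁿ + Σ_{j<n} v_j xʲ` -/

/-- `‖∏ s‖ = ∏ ‖·‖` over a multiset. [folklore] -/
private theorem norm_multiset_prod {K : Type*} [NormedField K] (s : Multiset K) :
    ‖s.prod‖ = (s.map fun x => ‖x‖).prod := by
  have h := map_multiset_prod (normHom : K →*₀ ℝ) s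
  simpa only [normHom_apply] using h

/-- The lower-order part has degree `< n`. [folklore] -/
private theorem degree_sum_lt (n : ℕ) (v : ℕ → ℝ) :
    (∑ j ∈ range n, C (v j) * X ^ j).degree < (n : WithBot ℕ) := by
  have h := degree_sum_fin_lt (fun i : Fin n => v i)
  rwa [← Finset.sum_range (fun j => C (v j) * X ^ j)] at h

/-- `xⁿ + Σ_{j<n} v_j xʲ` is monic of degree `n`. [folklore] -/
private theorem monic_fib (n : ℕ) (v : ℕ → ℝ) : (X ^ n + ∑ j ∈ range n, C (v j) * X ^ j).Monic :=
  monic_X_pow_add (degree_sum_lt n v)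

/-- `xⁿ + Σ_{j<n} v_j xʲ` has degree `n`. [folklore] -/
private theorem natDegree_fib (n : ℕ) (v : ℕ → ℝ) : (X ^ n + ∑ j ∈ range n, C (v j) * X ^ j).natDegree = n := by
  have h : (∑ j ∈ range n, C (v j) * X ^ j).degree < (X ^ n : ℝ[X]).degree := by
    rw [degree_X_pow]; exact degree_sum_lt n v
  rw [natDegree_add_eq_left_of_degree_lt h, natDegree_X_pow]

/-- The coefficients below the top. [folklore] -/
private theorem coeff_fib (n : ℕ) (v : ℕ → ℝ) {k : ℕ} (hk : k < n) :
    (X ^ n + ∑ j ∈ range n, C (v j) * X ^ j).coeff k = v k := by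
  rw [coeff_add, coeff_X_pow, if_neg hk.ne, zero_add, finsetSum_coeff]
  simp_rw [coeff_C_mul_X_pow]
  rw [Finset.sum_ite_eq (range n) k (fun j => v j), if_pos (mem_range.2 hk)]

/-- Complex evaluation of the fibre. [folklore] -/
private theorem eval_map_fib (n : ℕ) (v : ℕ → ℝ) (z : ℂ) :
    ((X ^ n + ∑ j ∈ range n, C (v j) * X ^ j).map (algebraMap ℝ ℂ)).eval z
      = z ^ n + ∑ j ∈ range n, (v j : ℂ) * z ^ j := by
  simp [Polynomial.map_sum, eval_finsetSum]

/-! ## The estimate `|Im z|ⁿ ≤ |P(z)|` for real-rooted monic `P` -/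

/-- For a real monic polynomial all of whose roots are real, `|Im z|^{deg P} ≤ |P(z)|` on `ℂ`
(`|z − x| ≥ |Im z|` for real `x`). [folklore] -/
private theorem abs_im_pow_le_norm_eval {p : ℝ[X]} (hmon : p.Monic) (hs : p.Splits) (z : ℂ) :
    |z.im| ^ p.natDegree ≤ ‖(p.map (algebraMap ℝ ℂ)).eval z‖ := by
  have hcard : Multiset.card p.roots = p.natDegree := (splits_iff_card_roots.1 hs)
  have heval : (p.map (algebraMap ℝ ℂ)).eval z = (p.roots.map fun x : ℝ => z - (x : ℂ)).prod := by
    conv_lhs => rw [hs.eq_prod_roots_of_monic hmon]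
    rw [Polynomial.map_multiset_prod, Multiset.map_map, eval_multiset_prod, Multiset.map_map]
    congr 1
    refine Multiset.map_congr rfl fun x _ => ?_
    simp
  rw [heval, norm_multiset_prod, Multiset.map_map]
  calc |z.im| ^ p.natDegree = (p.roots.map fun _ => |z.im|).prod := by
        rw [Multiset.map_const', Multiset.prod_replicate, hcard]
    _ ≤ (p.roots.map ((fun x : ℂ => ‖x‖) ∘ fun x : ℝ => z - (x : ℂ))).prod :=
        Multiset.prod_map_le_prod_map₀ _ _ (fun _ _ => abs_nonneg _) fun x _ => by
          have h := Complex.abs_im_le_norm (z - (x : ℂ))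
          simpa using h

/-! ## Closedness of real-rooted monic polynomials of fixed degree -/

/-- **Closedness** («by theorem 3.2 the set of polynomials with all roots real is closed», used in the proof of the
Multiplicity Lemma 3.7): if the monic real polynomials `xⁿ + Σ_{j<n} c_j(i) xʲ` are real-rooted (`Splits` over `ℝ`)
eventually along a nontrivial filter and their coefficients converge, `c_j(i) → c_j`, then the limit `xⁿ + Σ c_j xʲ` is
real-rooted.  (Proof: `|Im z|ⁿ ≤ |P_i(z)| → |P(z)|`, so every complex root of the limit is real.)
[cite: AlekseevskyEtAl1998, Theorem 3.2 and proof of Lemma 3.7 (p.4 L150–152)] -/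
theorem splits_of_tendsto {ι : Type*} {l : Filter ι} [l.NeBot] (n : ℕ) (c : ι → ℕ → ℝ) (c₀ : ℕ → ℝ)
    (hs : ∀ᶠ i in l, (X ^ n + ∑ j ∈ range n, C (c i j) * X ^ j).Splits)
    (hlim : ∀ j < n, Tendsto (fun i => c i j) l (𝓝 (c₀ j))) :
    (X ^ n + ∑ j ∈ range n, C (c₀ j) * X ^ j).Splits := by
  -- the pointwise bound in the limit
  have hbound : ∀ z : ℂ, |z.im| ^ n ≤ ‖((X ^ n + ∑ j ∈ range n, C (c₀ j) * X ^ j).map (algebraMap ℝ ℂ)).eval z‖ := by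
    intro z
    have hev : ∀ᶠ i in l, |z.im| ^ n ≤ ‖z ^ n + ∑ j ∈ range n, (c i j : ℂ) * z ^ j‖ := by
      filter_upwards [hs] with i hi
      have h := abs_im_pow_le_norm_eval (monic_fib n (c i)) hi z
      rwa [natDegree_fib, eval_map_fib] at h
    have htend : Tendsto (fun i => z ^ n + ∑ j ∈ range n, (c i j : ℂ) * z ^ j) l
        (𝓝 (z ^ n + ∑ j ∈ range n, (c₀ j : ℂ) * z ^ j)) := by
      refine tendsto_const_nhds.add (tendsto_finsetSum _ fun j hj => ?_)
      exact ((Complex.continuous_ofReal.tendsto _).comp (hlim j (mem_range.1 hj))).mul tendsto_const_nhds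
    rw [eval_map_fib]
    exact ge_of_tendsto htend.norm hev
  -- every complex root of the limit is real
  refine Splits.of_splits_map (algebraMap ℝ ℂ) (IsAlgClosed.splits _) fun a ha => ?_
  have hroot : ((X ^ n + ∑ j ∈ range n, C (c₀ j) * X ^ j).map (algebraMap ℝ ℂ)).eval a = 0 := by
    have hne : (X ^ n + ∑ j ∈ range n, C (c₀ j) * X ^ j).map (algebraMap ℝ ℂ) ≠ 0 :=
      Polynomial.map_ne_zero (monic_fib n c₀).ne_zero
    exact (mem_roots hne).1 ha
  have h0 : |a.im| ^ n ≤ 0 := by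
    have h := hbound a
    rw [hroot, norm_zero] at h
    exact h
  have him : a.im = 0 := by
    rcases Nat.eq_zero_or_pos n with hn | hn
    · subst hn; norm_num at h0
    · have : |a.im| ^ n = 0 := le_antisymm h0 (by positivity)
      exact abs_eq_zero.1 (pow_eq_zero_iff hn.ne' |>.1 this)
  exact ⟨a.re, Complex.ext (by simp) (by simp [him])⟩

/-! ## Lemma 3.6 -/

/-- `(Σ x)² = Σ x² + 2 e₂(x)` over a multiset. [folklore] -/
private theorem sum_sq_eq (s : Multiset ℝ) : s.sum ^ 2 = (s.map fun x => x ^ 2).sum + 2 * s.esymm 2 := by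
  induction s using Multiset.induction_on with
  | empty => simp [Multiset.esymm]
  | cons a t ih =>
    have aux : ∀ u : Multiset ℝ, (u.map fun x => a * x).sum = a * u.sum := fun u => by
      induction u using Multiset.induction_on with
      | empty => simp
      | cons b u ih => simp [ih, mul_add]
    have hes : (a ::ₘ t).esymm 2 = t.esymm 2 + a * t.sum := by
      simp [Multiset.esymm, Multiset.powersetCard_cons, Multiset.powersetCard_one, Multiset.map_map,
        Multiset.prod_cons, aux]
    rw [Multiset.sum_cons, Multiset.map_cons, Multiset.sum_cons, hes]
    linear_combination ih

/-- **Lemma 3.6** (AKLM 1998): a monic real polynomial of degree `n ≥ 2` with all roots real and with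
`a₁ = a₂ = 0` (the coefficients of `xⁿ⁻¹` and `xⁿ⁻²` vanish) is `xⁿ` — all its roots are `0`
(«`Σ xᵢ² = s₂ = σ₁² − 2σ₂ = a₁² − 2a₂ = 0`»). [cite: AlekseevskyEtAl1998, Lemma 3.6 (p.4 L90–97)] -/
theorem eq_X_pow_of_coeff_eq_zero (p : ℝ[X]) (hmon : p.Monic) (hs : p.Splits) (hn : 2 ≤ p.natDegree)
    (h1 : p.coeff (p.natDegree - 1) = 0) (h2 : p.coeff (p.natDegree - 2) = 0) :
    p = X ^ p.natDegree := by
  have hcard : Multiset.card p.roots = p.natDegree := splits_iff_card_roots.1 hs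
  have hprod := hs.eq_prod_roots_of_monic hmon
  -- Vieta for the two top coefficients
  have hc1 : p.coeff (p.natDegree - 1) = -p.roots.sum := by
    rw [← nextCoeff_of_natDegree_pos (by omega)]
    exact hs.nextCoeff_eq_neg_sum_roots_of_monic hmon
  have hc2 : p.coeff (p.natDegree - 2) = p.roots.esymm 2 := by
    rw [coeff_eq_esymm_roots_of_card hcard (by omega), hmon.leadingCoeff,
      show p.natDegree - (p.natDegree - 2) = 2 by omega]
    norm_num
  have hsum : p.roots.sum = 0 := by linarith [hc1.symm.trans h1]
  have he2 : p.roots.esymm 2 = 0 := by rw [← hc2, h2]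
  have hsq : (p.roots.map fun x => x ^ 2).sum = 0 := by
    have := sum_sq_eq p.roots
    rw [hsum, he2] at this
    linarith
  have hall : ∀ x ∈ p.roots, x = 0 := by
    have h0 : ∀ y ∈ p.roots.map (fun x => x ^ 2), y = (0 : ℝ) :=
      Multiset.all_zero_of_le_zero_le_of_sum_eq_zero
        (fun y hy => by obtain ⟨x, _, rfl⟩ := Multiset.mem_map.1 hy; positivity) hsq
    intro x hx
    have := h0 (x ^ 2) (Multiset.mem_map.2 ⟨x, hx, rfl⟩)
    exact pow_eq_zero_iff two_ne_zero |>.1 this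
  have hrep : p.roots = Multiset.replicate p.natDegree 0 := by
    rw [← hcard]; exact Multiset.eq_replicate_card.2 hall
  conv_lhs => rw [hprod, hrep, Multiset.map_replicate, Multiset.prod_replicate]
  simp

/-! ## The Multiplicity Lemma 3.7, (3) ⇒ (1), for polynomial coefficient curves -/

/-- The scaling identity behind the proof of Lemma 3.7: for `s > 0`, exponents `e_j` with
`p·n + e_j = q·m_j + p·j` whenever the `j`-th coefficient is nonzero, and `c_j = t^{m_j} g_j`,
`s^{pn} · (xⁿ + Σ s^{e_j} g_j(s^q) xʲ) = P(s^q)(s^p x)`. [folklore] -/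
private theorem scaling_identity (n p q : ℕ) (c g : ℕ → ℝ[X]) (m e : ℕ → ℕ)
    (hcg : ∀ j, c j = X ^ (m j) * g j) (he : ∀ j < n, c j ≠ 0 → p * n + e j = q * m j + p * j) (s : ℝ) :
    C (s ^ (p * n)) * (X ^ n + ∑ j ∈ range n, C (s ^ (e j) * (g j).eval (s ^ q)) * X ^ j)
      = (X ^ n + ∑ j ∈ range n, C ((c j).eval (s ^ q)) * X ^ j).comp (C (s ^ p) * X) := by
  have hsum : (∑ j ∈ range n, C ((c j).eval (s ^ q)) * X ^ j).comp (C (s ^ p) * X)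
      = ∑ j ∈ range n, C ((c j).eval (s ^ q) * (s ^ p) ^ j) * X ^ j := by
    have hcs : (∑ j ∈ range n, C ((c j).eval (s ^ q)) * X ^ j).comp (C (s ^ p) * X)
        = ∑ j ∈ range n, (C ((c j).eval (s ^ q)) * X ^ j).comp (C (s ^ p) * X) :=
      map_sum (compRingHom (C (s ^ p) * X)) (fun j => C ((c j).eval (s ^ q)) * X ^ j) (range n)
    rw [hcs]
    refine Finset.sum_congr rfl fun j _ => ?_
    rw [mul_comp, C_comp, X_pow_comp, mul_pow, ← C_pow, ← mul_assoc, ← C_mul]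
  have htop : ((C (s ^ p) * X) ^ n : ℝ[X]) = C (s ^ (p * n)) * X ^ n := by
    rw [mul_pow, ← C_pow, ← pow_mul]
  rw [add_comp, X_pow_comp, htop, hsum, mul_add, Finset.mul_sum]
  congr 1
  refine Finset.sum_congr rfl fun j hj => ?_
  have hjn : j < n := mem_range.1 hj
  rw [← mul_assoc, ← C_mul]
  congr 2
  by_cases hcj : c j = 0
  · have hg : g j = 0 := by
      have h := hcg j
      rw [hcj] at h
      rcases mul_eq_zero.1 h.symm with h' | h'
      · exact absurd h' (pow_ne_zero _ X_ne_zero)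
      · exact h'
    simp [hcj, hg]
  · have hexp := he j hjn hcj
    rw [hcg j, eval_mul, eval_pow, eval_X, ← pow_mul]
    have : s ^ (p * n) * s ^ (e j) = s ^ (q * m j) * (s ^ p) ^ j := by
      rw [← pow_add, hexp, pow_add, pow_mul, pow_mul]
    calc s ^ (p * n) * (s ^ e j * (g j).eval (s ^ q)) = (s ^ (p * n) * s ^ (e j)) * (g j).eval (s ^ q) := by ring
      _ = (s ^ (q * m j) * (s ^ p) ^ j) * (g j).eval (s ^ q) := by rw [this]
      _ = s ^ (q * m j) * (g j).eval (s ^ q) * (s ^ p) ^ j := by ring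

/-- **Multiplicity Lemma 3.7, (3) ⇒ (1)** (AKLM 1998), for a curve of monic real-rooted polynomials with POLYNOMIAL
coefficient functions.  Let `P(t)(x) = xⁿ + Σ_{j<n} c_j(t) xʲ` (`c_j ∈ ℝ[t]`, `n ≥ 2`) with `c_{n−1} = 0` (centred:
`a₁ = 0`) be real-rooted for all small `t > 0`.  If `t^{2r} ∣ c_{n−2}` (`m(a₂) ≥ 2r`) then `t^{kr} ∣ c_{n−k}` for every
`2 ≤ k ≤ n` (`m(aₖ) ≥ kr`).  Printed for `C^∞` curves with `m(·)` the order of flatness; proof as printed (minimal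
slope `p/q`, scaling `x = t^{p/q}u` written with `t = s^q`, closedness at `s → 0⁺`, Lemma 3.6).
[cite: AlekseevskyEtAl1998, Lemma 3.7 (p.4 L100 – p.5 L22)] -/
theorem multiplicity_lemma (n r : ℕ) (hn : 2 ≤ n) (c : ℕ → ℝ[X]) (hc1 : c (n - 1) = 0)
    (hsplit : ∀ᶠ t in 𝓝[>] (0 : ℝ), (X ^ n + ∑ j ∈ range n, C ((c j).eval t) * X ^ j).Splits)
    (h2 : X ^ (2 * r) ∣ c (n - 2)) :
    ∀ k, 2 ≤ k → k ≤ n → X ^ (k * r) ∣ c (n - k) := by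
  classical
  by_contra hbad
  push Not at hbad
  obtain ⟨k, hk2, hkn, hkdvd⟩ := hbad
  -- orders of vanishing and cofactors at `t = 0`
  set m : ℕ → ℕ := fun j => (c j).rootMultiplicity 0 with hm
  set g : ℕ → ℝ[X] := fun j => c j /ₘ X ^ (m j) with hg
  have hcg : ∀ j, c j = X ^ (m j) * g j := by
    intro j
    have h := pow_mul_divByMonic_rootMultiplicity_eq (c j) 0
    simp only [map_zero, sub_zero] at h
    exact h.symm
  have hg0 : ∀ j, c j ≠ 0 → (g j).eval 0 ≠ 0 := by
    intro j hj
    have h := eval_divByMonic_pow_rootMultiplicity_ne_zero (p := c j) 0 hj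
    simpa only [map_zero, sub_zero] using h
  have hdvd_iff : ∀ j (e : ℕ), c j ≠ 0 → (X ^ e ∣ c j ↔ e ≤ m j) := by
    intro j e hj
    have h := (le_rootMultiplicity_iff hj (a := (0 : ℝ)) (n := e)).symm
    simpa only [map_zero, sub_zero] using h
  -- the bad index
  set j₁ := n - k with hj₁
  have hcj₁ : c j₁ ≠ 0 := fun h => hkdvd (by rw [h]; exact dvd_zero _)
  have hmj₁ : m j₁ < (n - j₁) * r := by
    have : ¬ k * r ≤ m j₁ := fun h => hkdvd ((hdvd_iff j₁ _ hcj₁).2 h)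
    have hnj : n - j₁ = k := by omega
    rw [hnj]; omega
  -- the support and the minimal slope
  set S : Finset ℕ := (range n).filter fun j => c j ≠ 0 with hS
  have hj₁S : j₁ ∈ S := by
    rw [hS, mem_filter]; exact ⟨mem_range.2 (by omega), hcj₁⟩
  obtain ⟨j₀, hj₀S, hmin⟩ := Finset.exists_min_image S (fun j => (m j : ℚ) / ((n : ℚ) - j)) ⟨j₁, hj₁S⟩
  have hj₀n : j₀ < n := mem_range.1 (mem_filter.1 hj₀S).1
  have hcj₀ : c j₀ ≠ 0 := (mem_filter.1 hj₀S).2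
  set p : ℕ := m j₀ with hp
  set q : ℕ := n - j₀ with hq
  have hq0 : 0 < q := by omega
  -- integer consequences of minimality
  have hcross : ∀ j ∈ S, p * (n - j) ≤ q * m j := by
    intro j hj
    have hjn : j < n := mem_range.1 (mem_filter.1 hj).1
    have h := hmin j hj
    have hqpos : (0 : ℚ) < (n : ℚ) - j₀ := by
      have : (j₀ : ℚ) < n := by exact_mod_cast hj₀n
      linarith
    have hnjpos : (0 : ℚ) < (n : ℚ) - j := by
      have : (j : ℚ) < n := by exact_mod_cast hjn
      linarith
    rw [div_le_div_iff₀ hqpos hnjpos] at h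
    have h' : ((p * (n - j) : ℕ) : ℚ) ≤ ((q * m j : ℕ) : ℚ) := by
      push_cast [Nat.cast_sub hjn.le, Nat.cast_sub hj₀n.le, hp, hq]
      linarith
    exact_mod_cast h'
  have hpqr : p < q * r := by
    have h := hmin j₁ hj₁S
    have hqpos : (0 : ℚ) < (n : ℚ) - j₀ := by
      have : (j₀ : ℚ) < n := by exact_mod_cast hj₀n
      linarith
    have hj₁n : j₁ < n := by omega
    have hnjpos : (0 : ℚ) < (n : ℚ) - j₁ := by
      have : (j₁ : ℚ) < n := by exact_mod_cast hj₁n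
      linarith
    rw [div_le_div_iff₀ hqpos hnjpos] at h
    -- `p (n - j₁) ≤ q m_{j₁} < q (n - j₁) r`
    have h1 : ((p * (n - j₁) : ℕ) : ℚ) ≤ ((q * m j₁ : ℕ) : ℚ) := by
      push_cast [Nat.cast_sub hj₁n.le, Nat.cast_sub hj₀n.le, hp, hq]
      linarith
    have h1' : p * (n - j₁) ≤ q * m j₁ := by exact_mod_cast h1
    have h2' : q * m j₁ < q * ((n - j₁) * r) := Nat.mul_lt_mul_of_pos_left hmj₁ hq0
    have h3 : p * (n - j₁) < (q * r) * (n - j₁) := by nlinarith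
    exact lt_of_mul_lt_mul_right h3 (Nat.zero_le _)
  -- exponents of the rescaled curve
  set e : ℕ → ℕ := fun j => q * m j - p * (n - j) with hedef
  have he : ∀ j < n, c j ≠ 0 → p * n + e j = q * m j + p * j := by
    intro j hjn hcj
    have h := hcross j (mem_filter.2 ⟨mem_range.2 hjn, hcj⟩)
    have : p * (n - j) + p * j = p * n := by
      rw [← mul_add, Nat.sub_add_cancel hjn.le]
    simp only [hedef]
    omega
  -- the rescaled curve splits for small `s > 0`
  have hpow_tend : Tendsto (fun s : ℝ => s ^ q) (𝓝[>] (0 : ℝ)) (𝓝[>] (0 : ℝ)) := by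
    refine tendsto_nhdsWithin_iff.2 ⟨?_, ?_⟩
    · have h := ((continuous_pow q).tendsto (0 : ℝ)).mono_left (nhdsWithin_le_nhds (s := Set.Ioi (0 : ℝ)))
      rwa [zero_pow hq0.ne'] at h
    · filter_upwards [self_mem_nhdsWithin] with s hs
      exact pow_pos (Set.mem_Ioi.1 hs) q
  have hsplit' : ∀ᶠ s in 𝓝[>] (0 : ℝ),
      (X ^ n + ∑ j ∈ range n, C (s ^ (e j) * (g j).eval (s ^ q)) * X ^ j).Splits := by
    filter_upwards [hpow_tend.eventually hsplit, self_mem_nhdsWithin] with s hs hspos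
    have hspos' : (0 : ℝ) < s := hspos
    have hcomp := Splits.comp_of_natDegree_le_one_of_invertible (g := C (s ^ p) * X) hs
      ((natDegree_C_mul_le _ _).trans natDegree_X_le) ?_
    · rw [← scaling_identity n p q c g m e hcg he s] at hcomp
      exact (splits_mul_iff_right (C_ne_zero.2 (pow_ne_zero _ hspos'.ne')) (Splits.C _)).1 hcomp
    · rw [leadingCoeff_C_mul_X]
      exact invertibleOfNonzero (pow_ne_zero _ hspos'.ne')
  -- coefficientwise limits at `s → 0⁺`
  have hlim : ∀ j < n, Tendsto (fun s : ℝ => s ^ (e j) * (g j).eval (s ^ q)) (𝓝[>] (0 : ℝ))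
      (𝓝 ((0 : ℝ) ^ (e j) * (g j).eval 0)) := by
    intro j _
    have hcont : Continuous fun s : ℝ => s ^ (e j) * (g j).eval (s ^ q) :=
      (continuous_pow _).mul ((g j).continuous.comp (continuous_pow q))
    have h := (hcont.tendsto 0).mono_left (nhdsWithin_le_nhds (s := Set.Ioi (0 : ℝ)))
    simpa [zero_pow hq0.ne'] using h
  -- the limit polynomial splits (closedness) and is `xⁿ` (Lemma 3.6)
  have hQ := splits_of_tendsto n (fun s j => s ^ (e j) * (g j).eval (s ^ q)) (fun j => (0 : ℝ) ^ (e j) * (g j).eval 0)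
    hsplit' hlim
  set w₀ : ℕ → ℝ := fun j => (0 : ℝ) ^ (e j) * (g j).eval 0 with hw₀
  have hdegQ := natDegree_fib n w₀
  have hQ1 : (X ^ n + ∑ j ∈ range n, C (w₀ j) * X ^ j).coeff (n - 1) = 0 := by
    rw [coeff_fib n w₀ (by omega), hw₀]
    have : g (n - 1) = 0 := by
      have h := hcg (n - 1); rw [hc1] at h
      rcases mul_eq_zero.1 h.symm with h' | h'
      · exact absurd h' (pow_ne_zero _ X_ne_zero)
      · exact h'
    simp [this]
  have hQ2 : (X ^ n + ∑ j ∈ range n, C (w₀ j) * X ^ j).coeff (n - 2) = 0 := by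
    rw [coeff_fib n w₀ (by omega), hw₀]
    by_cases hc2 : c (n - 2) = 0
    · have : g (n - 2) = 0 := by
        have h := hcg (n - 2); rw [hc2] at h
        rcases mul_eq_zero.1 h.symm with h' | h'
        · exact absurd h' (pow_ne_zero _ X_ne_zero)
        · exact h'
      simp [this]
    · have hm2 : 2 * r ≤ m (n - 2) := (hdvd_iff (n - 2) _ hc2).1 h2
      have hepos : 0 < e (n - 2) := by
        simp only [hedef]
        have : n - (n - 2) = 2 := by omega
        rw [this]
        have : 2 * (q * r) ≤ q * m (n - 2) :=
          calc 2 * (q * r) = q * (2 * r) := by ring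
            _ ≤ q * m (n - 2) := Nat.mul_le_mul_left _ hm2
        omega
      simp [zero_pow hepos.ne']
  have hQX := eq_X_pow_of_coeff_eq_zero _ (monic_fib n w₀) hQ (by rw [hdegQ]; exact hn)
    (by rw [hdegQ]; exact hQ1) (by rw [hdegQ]; exact hQ2)
  -- but the `j₀`-th coefficient of the limit is `g_{j₀}(0) ≠ 0`
  have hej₀ : e j₀ = 0 := by
    simp only [hedef, hp, hq]
    rw [mul_comm]
    exact Nat.sub_self _
  have hcoef : (X ^ n + ∑ j ∈ range n, C (w₀ j) * X ^ j).coeff j₀ = (g j₀).eval 0 := by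
    rw [coeff_fib n w₀ hj₀n, hw₀]
    simp [hej₀]
  rw [hQX, hdegQ, coeff_X_pow, if_neg hj₀n.ne] at hcoef
  exact hg0 j₀ hcj₀ hcoef.symm

end AKLM

end Literature.Algebra.Polynomial

end
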